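import Mathlib
import Literature.Analysis.FluidPDE.AxisymVorticityAlgebra
import Summits.NavierStokesRegularity.NavierStokesRegularity.Theorems.FilamentSkeletonRssDefectColumnGateSectional2D
import Summits.NavierStokesRegularity.NavierStokesRegularity.Theorems.FilamentSkeletonRssDefectColumnGateSeparable2D

/-!
# Route `FilamentSkeletonRss` · crux `TransverseReduction1AG` (stmt-NavierStokesRegularity-27853) · line `defect_column_gate_1AG` —
# the S2a operator on a RADIAL stream function: the m = 0 sector of `colForceVort` IS the total-derivative radial block

Helper file (theorems only, `--supports stmt-NavierStokesRegularity-27853 --as helper`; LEAD of 27853, lane ns-filament-21221-p1 g11).  The DICTIONARY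
between the stub S2a-loc `WaistColumnGateLoc1A` (Defs §7) and the radial block landed in `Theorems/…DefectColumnGateRadialBlock.lean` (p661788):
for a radial stream function `Ψ(y) = ψ(q)`, `q = y₀² + y₁²` (axis `d = e₃`), the perturbation `W = ∇Ψ × e₃ = 2ψ′(q)·(y₁, −y₀, 0)` is the axisymmetric
swirl, `curl W = w(q)·e₃` with `w(u) = −(4uψ″(u) + 4ψ′(u))` (`laplacian_rad`), and for the frozen waist column with SYMMETRIC sectional strain
`B = diag(−γ/2, −γ/2, 3/2+γ)` (any rate `α`, any circulation `Rc`) the S2a operator is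
`colForceVort B α γ Rc e₃ W (y) = −(4q w″(q) + 4 w′(q) + γ q w′(q) + γ w(q))·e₃` (`colForceVort_rad`): the swirl transport `Dw[S]`, the Biot–Savart
term `W·∇ζ` and the tilting `DW[Ω_bg]` all vanish on this sector (kernel-checked, from `colForceVort_streamField`, p653585).  (`secWt e₃ y = 1 + q` is
`secWt_e3` of `Theorems/…QuasimodeWitness.lean`.)  With these, `radialBlock_apriori_deriv2` is literally the m = 0 case of the stub's a-priori estimate (assembled in
`Theorems/…DefectColumnGateRadialGate.lean`).  HONEST FRAMING: calculus identities about the MODEL operator of a hypothetical blow-up route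
(MODEL rung, negative side); no stub is proved or refuted here; nothing here bears on Navier–Stokes regularity.
-/

set_option linter.dupNamespace false

noncomputable section

namespace Summit.NavierStokesRegularity.NavierStokesRegularity.Theorems.DefectColumnGate

open scoped BigOperators Topology InnerProductSpace Laplacian ContDiff
open Set Function
open Literature.Analysis.FluidPDE
open Summit.NavierStokesRegularity.NavierStokesRegularity.Theorems.KelvinGate

/-! ## 1. First derivative of a radial scalar `y ↦ ψ(y₀² + y₁²)` -/

/-- `D(ψ(q))(y) = ψ′(q)·(2y₀·pr₀ + 2y₁·pr₁)`. -/
theorem hasFDerivAt_rad {ψ : ℝ → ℝ} {ψ' : ℝ} {y : EuclideanSpace ℝ (Fin 3)} (hψ : HasDerivAt ψ ψ' (y 0 ^ 2 + y 1 ^ 2)) :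
    HasFDerivAt (fun y : EuclideanSpace ℝ (Fin 3) => ψ (y 0 ^ 2 + y 1 ^ 2))
      (ψ' • ((2 * y 0) • (EuclideanSpace.proj (0 : Fin 3) : EuclideanSpace ℝ (Fin 3) →L[ℝ] ℝ) +
        (2 * y 1) • (EuclideanSpace.proj (1 : Fin 3) : EuclideanSpace ℝ (Fin 3) →L[ℝ] ℝ))) y :=
  hψ.comp_hasFDerivAt y (hasFDerivAt_horizSq y)

/-- Applied form: `D(ψ(q))(y)[v] = ψ′(q)·(2y₀v₀ + 2y₁v₁)`. -/
theorem fderiv_rad_apply {ψ : ℝ → ℝ} {ψ' : ℝ} {y : EuclideanSpace ℝ (Fin 3)} (hψ : HasDerivAt ψ ψ' (y 0 ^ 2 + y 1 ^ 2))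
    (v : EuclideanSpace ℝ (Fin 3)) :
    fderiv ℝ (fun y : EuclideanSpace ℝ (Fin 3) => ψ (y 0 ^ 2 + y 1 ^ 2)) y v = ψ' * (2 * y 0 * v 0 + 2 * y 1 * v 1) := by
  rw [(hasFDerivAt_rad hψ).fderiv]
  have hp : ∀ (i : Fin 3) (z : EuclideanSpace ℝ (Fin 3)), (EuclideanSpace.proj i : EuclideanSpace ℝ (Fin 3) →L[ℝ] ℝ) z = z i :=
    fun _ _ => rfl
  simp only [_root_.add_apply, _root_.smul_apply, smul_eq_mul, hp]

/-- `ψ(q) ∈ Cⁿ` for `ψ ∈ Cⁿ`. -/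
theorem contDiff_rad {ψ : ℝ → ℝ} {n : WithTop ℕ∞} (hψ : ContDiff ℝ n ψ) :
    ContDiff ℝ n (fun y : EuclideanSpace ℝ (Fin 3) => ψ (y 0 ^ 2 + y 1 ^ 2)) :=
  hψ.comp contDiff_horizSq

/-- Axial constancy: `D(ψ(q))(y)[e₃] = 0`. -/
theorem fderiv_rad_axis {ψ : ℝ → ℝ} (hψ : Differentiable ℝ ψ) (y : EuclideanSpace ℝ (Fin 3)) :
    fderiv ℝ (fun y : EuclideanSpace ℝ (Fin 3) => ψ (y 0 ^ 2 + y 1 ^ 2)) y (EuclideanSpace.single 2 1) = 0 := by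
  rw [fderiv_rad_apply (hψ _).hasDerivAt]
  simp

/-- The gradient: `∇(ψ(q))(y) = 2ψ′(q)y₀·e₀ + 2ψ′(q)y₁·e₁`. -/
theorem gradient_rad {ψ : ℝ → ℝ} {ψ' : ℝ} {y : EuclideanSpace ℝ (Fin 3)} (hψ : HasDerivAt ψ ψ' (y 0 ^ 2 + y 1 ^ 2)) :
    gradient (fun y : EuclideanSpace ℝ (Fin 3) => ψ (y 0 ^ 2 + y 1 ^ 2)) y =
      (2 * ψ' * y 0) • EuclideanSpace.single 0 1 + (2 * ψ' * y 1) • EuclideanSpace.single 1 1 := by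
  refine ext_inner_right ℝ fun v => ?_
  rw [Literature.Analysis.FluidPDE.inner_gradient_left, fderiv_rad_apply hψ v, inner_add_left, real_inner_smul_left, real_inner_smul_left,
    EuclideanSpace.inner_single_left, EuclideanSpace.inner_single_left]
  simp; ring

/-- The axisymmetric swirl: `∇(ψ(q)) × e₃ = 2ψ′(q)·(y₁ e₀ − y₀ e₁)`. -/
theorem streamField_rad {ψ : ℝ → ℝ} {ψ' : ℝ} {y : EuclideanSpace ℝ (Fin 3)} (hψ : HasDerivAt ψ ψ' (y 0 ^ 2 + y 1 ^ 2)) :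
    cross (gradient (fun y : EuclideanSpace ℝ (Fin 3) => ψ (y 0 ^ 2 + y 1 ^ 2)) y) (EuclideanSpace.single 2 1) =
      (2 * ψ' * y 1) • EuclideanSpace.single 0 1 - (2 * ψ' * y 0) • EuclideanSpace.single 1 1 := by
  rw [gradient_rad hψ]
  ext i
  fin_cases i <;> simp [cross, crossProduct, Matrix.cons_val_zero, Matrix.cons_val_one]

/-! ## 2. The Laplacian of a radial scalar -/

/-- `Δ(ψ(q))(y) = 4q ψ″(q) + 4 ψ′(q)` (`q = y₀² + y₁²`) for `ψ ∈ C²`. -/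
theorem laplacian_rad {ψ : ℝ → ℝ} (hψ : ContDiff ℝ 2 ψ) (y : EuclideanSpace ℝ (Fin 3)) :
    (Δ (fun y : EuclideanSpace ℝ (Fin 3) => ψ (y 0 ^ 2 + y 1 ^ 2))) y =
      4 * (y 0 ^ 2 + y 1 ^ 2) * deriv (deriv ψ) (y 0 ^ 2 + y 1 ^ 2) + 4 * deriv ψ (y 0 ^ 2 + y 1 ^ 2) := by
  have hψ1 : Differentiable ℝ ψ := hψ.differentiable (by norm_num)
  have hdψ : ContDiff ℝ 1 (deriv ψ) := by
    have := hψ.iterate_deriv' 1 1; simpa using this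
  have hdψ1 : Differentiable ℝ (deriv ψ) := hdψ.differentiable (by norm_num)
  set P0 : EuclideanSpace ℝ (Fin 3) →L[ℝ] ℝ := EuclideanSpace.proj (0 : Fin 3) with hP0
  set P1 : EuclideanSpace ℝ (Fin 3) →L[ℝ] ℝ := EuclideanSpace.proj (1 : Fin 3) with hP1
  have hp : ∀ (i : Fin 3) (z : EuclideanSpace ℝ (Fin 3)), (EuclideanSpace.proj i : EuclideanSpace ℝ (Fin 3) →L[ℝ] ℝ) z = z i :=
    fun _ _ => rfl
  -- the first derivative as a function: `DΨ(z) = (2ψ′(q)z₀)·P0 + (2ψ′(q)z₁)·P1`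
  have hD1 : fderiv ℝ (fun y : EuclideanSpace ℝ (Fin 3) => ψ (y 0 ^ 2 + y 1 ^ 2)) =
      fun z => (2 * deriv ψ (z 0 ^ 2 + z 1 ^ 2) * z 0) • P0 + (2 * deriv ψ (z 0 ^ 2 + z 1 ^ 2) * z 1) • P1 := by
    funext z
    rw [(hasFDerivAt_rad (hψ1 _).hasDerivAt).fderiv, smul_add, smul_smul, smul_smul]
    congr 1 <;> congr 1 <;> ring
  -- the coefficient functions and their derivatives at `y`
  have hc : HasFDerivAt (fun z : EuclideanSpace ℝ (Fin 3) => deriv ψ (z 0 ^ 2 + z 1 ^ 2))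
      (deriv (deriv ψ) (y 0 ^ 2 + y 1 ^ 2) • ((2 * y 0) • P0 + (2 * y 1) • P1)) y :=
    hasFDerivAt_rad (hdψ1 _).hasDerivAt
  have ha : HasFDerivAt (fun z : EuclideanSpace ℝ (Fin 3) => 2 * deriv ψ (z 0 ^ 2 + z 1 ^ 2) * z 0)
      ((2 * deriv ψ (y 0 ^ 2 + y 1 ^ 2)) • P0 +
        (2 * y 0) • (deriv (deriv ψ) (y 0 ^ 2 + y 1 ^ 2) • ((2 * y 0) • P0 + (2 * y 1) • P1))) y := by
    have h := ((hc.const_mul (2:ℝ)).mul (P0.hasFDerivAt (x := y)))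
    refine h.congr_fderiv ?_
    ext v
    simp only [hP0, hP1, hp, _root_.add_apply, _root_.smul_apply, smul_eq_mul]
    ring
  have hb : HasFDerivAt (fun z : EuclideanSpace ℝ (Fin 3) => 2 * deriv ψ (z 0 ^ 2 + z 1 ^ 2) * z 1)
      ((2 * deriv ψ (y 0 ^ 2 + y 1 ^ 2)) • P1 +
        (2 * y 1) • (deriv (deriv ψ) (y 0 ^ 2 + y 1 ^ 2) • ((2 * y 0) • P0 + (2 * y 1) • P1))) y := by
    have h := ((hc.const_mul (2:ℝ)).mul (P1.hasFDerivAt (x := y)))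
    refine h.congr_fderiv ?_
    ext v
    simp only [hP0, hP1, hp, _root_.add_apply, _root_.smul_apply, smul_eq_mul]
    ring
  have hD2 : HasFDerivAt (fderiv ℝ (fun y : EuclideanSpace ℝ (Fin 3) => ψ (y 0 ^ 2 + y 1 ^ 2)))
      (((2 * deriv ψ (y 0 ^ 2 + y 1 ^ 2)) • P0 +
          (2 * y 0) • (deriv (deriv ψ) (y 0 ^ 2 + y 1 ^ 2) • ((2 * y 0) • P0 + (2 * y 1) • P1))).smulRight P0 +
        ((2 * deriv ψ (y 0 ^ 2 + y 1 ^ 2)) • P1 +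
          (2 * y 1) • (deriv (deriv ψ) (y 0 ^ 2 + y 1 ^ 2) • ((2 * y 0) • P0 + (2 * y 1) • P1))).smulRight P1) y := by
    rw [hD1]
    exact (ha.smul_const P0).add (hb.smul_const P1)
  rw [KelvinGate.laplacian_eq_sum_fderiv_fderiv]
  simp only
  rw [hD2.fderiv]
  simp [Fin.sum_univ_three, hP0, hP1, ContinuousLinearMap.smulRight_apply]
  ring

/-! ## 3. The S2a operator on the radial sector -/

/-- **THE S2a OPERATOR ON THE RADIAL SECTOR (symmetric sectional strain).**  `B = diag(−γ/2, −γ/2, 3/2+γ)`, any `α`, any `Rc`,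
`Ψ(y) = ψ(y₀²+y₁²)` with `ψ ∈ C⁴`, `W = ∇Ψ × e₃`, `w(u) := −(4u ψ″(u) + 4 ψ′(u))` (so `curl W = w(q)e₃`):
`colForceVort B α γ Rc e₃ W (y) = −(4q w″(q) + 4 w′(q) + γ q w′(q) + γ w(q))·e₃`, `q = y₀² + y₁²`.
(The swirl transport, the Biot–Savart multiplication term and the tilting term of `colForceVort_streamField` vanish identically here.) -/
theorem colForceVort_rad {ψ : ℝ → ℝ} (hψ : ContDiff ℝ 4 ψ)
    {B : EuclideanSpace ℝ (Fin 3) →L[ℝ] EuclideanSpace ℝ (Fin 3)} {γ α Rc : ℝ}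
    (hB0 : B (EuclideanSpace.single 0 1) = (-(γ / 2)) • EuclideanSpace.single 0 1)
    (hB1 : B (EuclideanSpace.single 1 1) = (-(γ / 2)) • EuclideanSpace.single 1 1)
    (hB2 : B (EuclideanSpace.single 2 1) = (3 / 2 + γ) • EuclideanSpace.single 2 1)
    (w : ℝ → ℝ) (hw : ∀ u, w u = -(4 * u * deriv (deriv ψ) u + 4 * deriv ψ u)) (y : EuclideanSpace ℝ (Fin 3)) :
    colForceVort B α γ Rc (EuclideanSpace.single 2 1)
        (fun z => cross (gradient (fun y : EuclideanSpace ℝ (Fin 3) => ψ (y 0 ^ 2 + y 1 ^ 2)) z) (EuclideanSpace.single 2 1)) y =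
      (-(4 * (y 0 ^ 2 + y 1 ^ 2) * deriv (deriv w) (y 0 ^ 2 + y 1 ^ 2) + 4 * deriv w (y 0 ^ 2 + y 1 ^ 2)
          + γ * (y 0 ^ 2 + y 1 ^ 2) * deriv w (y 0 ^ 2 + y 1 ^ 2) + γ * w (y 0 ^ 2 + y 1 ^ 2))) • EuclideanSpace.single 2 1 := by
  -- regularity bookkeeping
  have hψ2 : ContDiff ℝ 2 ψ := hψ.of_le (by norm_num)
  have hψ1 : Differentiable ℝ ψ := hψ.differentiable (by norm_num)
  have hd1 : ContDiff ℝ 3 (deriv ψ) := by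
    have := hψ.iterate_deriv' 3 1; simpa using this
  have hd2 : ContDiff ℝ 2 (deriv (deriv ψ)) := by
    have := hψ.iterate_deriv' 2 2; simpa using this
  -- `w` as a `C²` function of `u` and the vorticity `−ΔΨ = w(q)` as a function on `ℝ³`
  have hwfun : w = fun u => -(4 * u * deriv (deriv ψ) u + 4 * deriv ψ u) := funext hw
  have hwC : ContDiff ℝ 2 w := by
    rw [hwfun]
    exact (((contDiff_const.mul contDiff_id).mul hd2).add (contDiff_const.mul (hd1.of_le (by norm_num)))).neg
  have hw1 : Differentiable ℝ w := hwC.differentiable (by norm_num)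
  have hdw : ContDiff ℝ 1 (deriv w) := by
    have := hwC.iterate_deriv' 1 1; simpa using this
  have hdw1 : Differentiable ℝ (deriv w) := hdw.differentiable (by norm_num)
  have hvort : (fun z => -(Δ (fun y : EuclideanSpace ℝ (Fin 3) => ψ (y 0 ^ 2 + y 1 ^ 2))) z) =
      fun z : EuclideanSpace ℝ (Fin 3) => w (z 0 ^ 2 + z 1 ^ 2) := by
    funext z; rw [laplacian_rad hψ2 z, hw]
  -- hypotheses of `colForceVort_streamField`
  have hΨ : ContDiff ℝ 4 (fun y : EuclideanSpace ℝ (Fin 3) => ψ (y 0 ^ 2 + y 1 ^ 2)) := contDiff_rad hψ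
  have hax : ∀ z, fderiv ℝ (fun y : EuclideanSpace ℝ (Fin 3) => ψ (y 0 ^ 2 + y 1 ^ 2)) z (EuclideanSpace.single 2 1) = 0 :=
    fderiv_rad_axis hψ1
  have hon : Orthonormal ℝ ![EuclideanSpace.single (2 : Fin 3) (1 : ℝ), EuclideanSpace.single 0 1, EuclideanSpace.single 1 1] := by
    rw [orthonormal_iff_ite]
    intro i j
    fin_cases i <;> fin_cases j <;> simp [EuclideanSpace.inner_single_left]
  have htr : ⟪B (EuclideanSpace.single 0 1), EuclideanSpace.single (0 : Fin 3) (1 : ℝ)⟫_ℝ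
      + ⟪B (EuclideanSpace.single 1 1), EuclideanSpace.single (1 : Fin 3) (1 : ℝ)⟫_ℝ = 3 / 2 - (3 / 2 + γ) := by
    rw [hB0, hB1, real_inner_smul_left, real_inner_smul_left]
    simp
    ring
  have hdivU : VectorCalculus.IsDivFree (colBase B α γ Rc (EuclideanSpace.single 2 1)) := isDivFree_colBase hon hB2 htr α γ Rc
  -- the stream-function form of the operator
  rw [colForceVort_streamField hB2 hdivU hΨ hax y, hvort]
  -- the pieces: `Dw(q)[v]`, `Δ(w(q))`, `B y`, the swirl, the tilting
  have hDw : ∀ v, fderiv ℝ (fun z : EuclideanSpace ℝ (Fin 3) => w (z 0 ^ 2 + z 1 ^ 2)) y v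
      = deriv w (y 0 ^ 2 + y 1 ^ 2) * (2 * y 0 * v 0 + 2 * y 1 * v 1) := fun v => fderiv_rad_apply (hw1 _).hasDerivAt v
  have hΔw := laplacian_rad hwC y
  have hBy := apply_of_diag hB0 hB1 hB2 y
  have hΩ : curlCLM B = 0 := curlCLM_of_diag hB0 hB1 hB2
  have htilt : fderiv ℝ (fun z => cross (gradient (fun y : EuclideanSpace ℝ (Fin 3) => ψ (y 0 ^ 2 + y 1 ^ 2)) z)
      (EuclideanSpace.single 2 1)) y (curlCLM B + (2 * α) • EuclideanSpace.single 2 1) = 0 := by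
    rw [hΩ, zero_add, map_smul, fderiv_streamField_axis (contDiff_rad hψ2) hax y, smul_zero]
  have hW := streamField_rad (y := y) (hψ1 _).hasDerivAt
  -- component facts
  have hc0 : (cross (EuclideanSpace.single (2 : Fin 3) (1 : ℝ)) y) 0 = -(y 1) := by simp [cross, cross_apply]
  have hc1 : (cross (EuclideanSpace.single (2 : Fin 3) (1 : ℝ)) y) 1 = y 0 := by simp [cross, cross_apply]
  -- the swirl transport vanishes on radial data: `Dw(q)[S y] = 0`
  have hswirl : fderiv ℝ (fun z : EuclideanSpace ℝ (Fin 3) => w (z 0 ^ 2 + z 1 ^ 2)) y (colSwirl γ Rc (EuclideanSpace.single 2 1) y) = 0 := by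
    rw [hDw]
    simp only [colSwirl, PiLp.smul_apply, smul_eq_mul, hc0, hc1]
    ring
  -- the Biot–Savart multiplication term vanishes: `⟨y − y₂e₃, W y⟩ = 0`
  have hinner : ⟪y - ⟪y, EuclideanSpace.single (2 : Fin 3) (1 : ℝ)⟫_ℝ • EuclideanSpace.single (2 : Fin 3) (1 : ℝ),
      cross (gradient (fun y : EuclideanSpace ℝ (Fin 3) => ψ (y 0 ^ 2 + y 1 ^ 2)) y) (EuclideanSpace.single 2 1)⟫_ℝ = 0 := by
    rw [hW, PiLp.inner_apply]
    simp [Fin.sum_univ_three]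
    ring
  -- the transport by the linear flow on radial data: `Dw(q)[B y] = −γ q w′(q)`
  have hlin : fderiv ℝ (fun z : EuclideanSpace ℝ (Fin 3) => w (z 0 ^ 2 + z 1 ^ 2)) y (B y)
      = -(γ * (y 0 ^ 2 + y 1 ^ 2) * deriv w (y 0 ^ 2 + y 1 ^ 2)) := by
    rw [hDw, hBy]
    simp
    ring
  rw [hswirl, hinner, htilt, hlin, hΔw, sub_zero, mul_zero, add_zero, add_zero, laplacian_rad hψ2 y,
    hw (y 0 ^ 2 + y 1 ^ 2)]
  congr 1
  ring

end Summit.NavierStokesRegularity.NavierStokesRegularity.Theorems.DefectColumnGate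

end
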